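import Summits.Ventures.CertifiedManyBodySolver.Observables.SourcedTorusTTPrimeT0AHM
import Summits.Ventures.CertifiedManyBodySolver.Observables.CrutchODLROFloor
import Literature.MathematicalPhysics.QuantumLattice.DWaveSourceNNNHoppingEnergyDensityLimit

/-!
# Bogoliubov Jr.'s approximating-Hamiltonian method for the pair-sourced `t–t'` torus WITH A BASE
# FIELD — 3/3: localisation, the two-sided envelope, and the crutch card's D1 object by name

Cell `hubbard-cq` (venture `CertifiedManyBodySolver`). With `A_L(h) = dWaveSourceTorusTT' L t' U μ h`,
`Δ_d = pairField dWaveFormFactor L`, `H_{g,L}(h₀) = A_L(h₀) − (g/L²) Δ_dᴴ Δ_d`, `‖P‖ = 2Σ_e|d(e)/√2|`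
(files 1/3 `SourcedTorusTTPrimeAHMToolkit.lean` = easy half + locality, 2/3
`SourcedTorusTTPrimeT0AHM.lean` = hard half):

* `ahmTT'_abs_sub_le_of_bound` — localisation of any near-optimal field, `|h − h₀| ≤ 2g‖P‖ + √(gε)`
  (easy half at `h = h₀` + the Lipschitz bound `abs_groundEnergy_dWaveSourceTorusTT'_sub_le`: the
  coercivity of the approximating free energy, quantitative);
* `ahmTT'_t0` — both halves packaged, `h ∈ [h₀, h₀ + 2g‖P‖ + √(gε)]`;
* `crutchTorusTT'_eq_model`, `crutchTorusTT'_groundEnergy_envelope` — the `h₀ = 0` case ON THE CARD'S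
  D1 OBJECT BY NAME, `crutchTorusTT' L t' U μ g` of `Observables/CrutchODLROFloor.lean`
  (card `bcs-crutch-odlro-floor`, hubbard-pc-lens-finite-1 / hubbard-cq-p2).

READING (transplant-1 DICTIONARY §12 step F1-T0 on the sourced `t–t'` torus; card
`bcs-crutch-odlro-floor`, BN-T1 «does-not-give» column as a finite-volume THEOREM): uniformly on
compacts of `(μ, h₀)`, `E₀(H_{g,L}(h₀))/L² = inf_{h ≥ h₀} [E₀(A_L(h))/L² + (h − h₀)²/g] + o(1)` as
`L → ∞`, the infimum being attained up to `o(1)` within `2g‖P‖ + o(1)` of `h₀`: the crutch ground-state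
energy is the Moreau envelope of the SOURCED energy curve and carries no bit beyond it.

HONEST SCOPE / WHAT THIS IS NOT: `H_{g,L}` is the BCS-crutch Hamiltonian, NOT the Hubbard model;
nothing at `g = 0`; no order-parameter floor (the floor reading of the crutch is
`Observables/CrutchODLROFloor.lean`), no phase sentence; finite torus, no thermodynamic limit taken.
Everything PROVED; no definition, no named fact. Default `DecidableEq (FermionTorus 2 L)` instance
throughout (also for `E₀(crutchTorusTT' …)`; consumers working under the row files' local
`LinearOrder.toDecidableEq` instance bridge the `groundEnergy` terms with `convert`).

References: Bogolyubov Jr.–Brankov–Zagrebnov–Kurbatov–Tonchev, Russ. Math. Surveys 39:6 (1984);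
Bru–de Siqueira Pedra, Mem. AMS 224 (2013), Appendix, Theorem 107; R. B. Israel, *Convexity in the
theory of lattice gases* (1979), Thm. I.3.4 (Lipschitz continuity in the field).
-/

noncomputable section

namespace Summit.Ventures.CertifiedManyBodySolver.Observables.SourcedTorusAHM

open Matrix Finset Filter Topology Literature.MathematicalPhysics.QuantumLattice
open Literature.Probability.LatticeModels
open Summit.HubbardSuperconductivity.HubbardSuperconductivity.Theorems
open Summit.HubbardSuperconductivity.HubbardSuperconductivity.Theorems.TwSeededEnsembleEquivalence.Negative
open scoped ComplexOrder Matrix.Norms.L2Operator ComplexConjugate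

/-! ### Localisation and the two-sided envelope -/

section Envelope

/-- **Localisation of a near-optimal field.** If `E₀(A_L(h)) + (h − h₀)²L²/g ≤
E₀(A_L(h₀) − (g/L²)Δ_dᴴΔ_d) + εL²` (the conclusion of `ahmTT'_groundEnergy_bound`) then
`|h − h₀| ≤ 2g‖P‖ + √(gε)`, `‖P‖ = 2Σ_e|d(e)/√2|`: combine with the easy half at `h = h₀`
(`E₀(model) ≤ E₀(A_L(h₀))`) and the Lipschitz bound
`|E₀(A_L(h₀)) − E₀(A_L(h))| ≤ 2‖P‖L²|h − h₀|` (`abs_groundEnergy_dWaveSourceTorusTT'_sub_le`) to get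
`(h − h₀)² ≤ 2g‖P‖|h − h₀| + gε`. This is the coercivity of the approximating free energy in the
amplitude (Bru–de Siqueira Pedra 2013, Theorem 107 (i)), made quantitative. -/
theorem ahmTT'_abs_sub_le_of_bound (L : ℕ) [NeZero L] (tp U μ h₀ h : ℝ) {g ε : ℝ} (hg : 0 < g)
    (hε : 0 ≤ ε)
    (hb : (dWaveSourceTorusTT' L tp U μ h).groundEnergy + (h - h₀) ^ 2 * (L : ℝ) ^ 2 / g ≤
      (dWaveSourceTorusTT' L tp U μ h₀ - ((g / (L : ℝ) ^ 2 : ℝ) : ℂ) •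
          ((pairField dWaveFormFactor L)ᴴ * pairField dWaveFormFactor L)).groundEnergy +
        ε * (L : ℝ) ^ 2) :
    |h - h₀| ≤ 2 * g * (2 * ∑ e ∈ insert (0 : Site 2) unitSteps, |dWaveFormFactor e / Real.sqrt 2|) +
      Real.sqrt (g * ε) := by
  set pd := (2 * ∑ e ∈ insert (0 : Site 2) unitSteps, |dWaveFormFactor e / Real.sqrt 2|) with hpd
  have hpd0 : 0 ≤ pd := by positivity
  have hV : (0 : ℝ) < (L : ℝ) ^ 2 := cast_sq_pos_of_neZero L
  have heasy := ahmTT'_groundEnergy_model_le L tp U μ h₀ h₀ hg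
  rw [sub_self, zero_pow two_ne_zero, zero_mul, zero_div, add_zero] at heasy
  have hlip := abs_groundEnergy_dWaveSourceTorusTT'_sub_le tp U μ L h₀ h
  have hlip' : (dWaveSourceTorusTT' L tp U μ h₀).groundEnergy -
      (dWaveSourceTorusTT' L tp U μ h).groundEnergy ≤ 2 * (pd * (L : ℝ) ^ 2) * |h - h₀| := by
    rw [abs_sub_comm h h₀]
    exact (le_abs_self _).trans hlip
  -- `(h − h₀)² ≤ 2g‖P‖|h − h₀| + gε`
  have hquad : |h - h₀| * |h - h₀| ≤ 2 * g * pd * |h - h₀| + g * ε := by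
    have h1 : (h - h₀) ^ 2 * (L : ℝ) ^ 2 / g ≤
        2 * (pd * (L : ℝ) ^ 2) * |h - h₀| + ε * (L : ℝ) ^ 2 := by
      linarith
    rw [div_le_iff₀ hg] at h1
    rw [← sq_abs, pow_two] at h1
    have h2 : (|h - h₀| * |h - h₀|) * (L : ℝ) ^ 2 ≤
        (2 * g * pd * |h - h₀| + g * ε) * (L : ℝ) ^ 2 := by
      linarith
    exact le_of_mul_le_mul_right h2 hV
  have hs : 0 ≤ Real.sqrt (g * ε) := Real.sqrt_nonneg _
  have hs2 : Real.sqrt (g * ε) * Real.sqrt (g * ε) = g * ε := Real.mul_self_sqrt (by positivity)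
  by_contra hnot
  rw [not_le] at hnot
  have hgpd : 0 ≤ 2 * g * pd := by positivity
  have hupos : 0 < |h - h₀| := lt_of_le_of_lt (by positivity) hnot
  have hlt : (2 * g * pd + Real.sqrt (g * ε)) * |h - h₀| < |h - h₀| * |h - h₀| :=
    mul_lt_mul_of_pos_right hnot hupos
  have hsu : Real.sqrt (g * ε) * Real.sqrt (g * ε) ≤ Real.sqrt (g * ε) * |h - h₀| :=
    mul_le_mul_of_nonneg_left (by linarith) hs
  linarith

/-- **The `T = 0` approximating-Hamiltonian bound for the pair-sourced `t–t'` torus with a base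
field, both halves** (Bogoliubov Jr.'s method for the BCS-crutch Hamiltonian
`H_{g,L}(h₀) = A_L(h₀) − (g/L²)Δ_dᴴΔ_d`, `A_L(h) = dWaveSourceTorusTT' L t' U μ h`):
* (easy, every `L`, `μ`, `h₀`, `h`) `E₀(H_{g,L}(h₀)) ≤ E₀(A_L(h)) + (h − h₀)²L²/g`;
* (hard, `∀ ε > 0 ∃ L₀ ∀ L ≥ L₀ ∀ |μ| ≤ M ∀ h₀ ∈ [0, H₀] ∃ h ∈ [h₀, h₀ + 2g‖P‖ + √(gε)]`)
  `E₀(A_L(h)) + (h − h₀)²L²/g ≤ E₀(H_{g,L}(h₀)) + εL²`.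
READING (the crutch card's «does-not-give» column, DICTIONARY BN-T1, as a finite-volume theorem): the
ground-state energy density of the crutch Hamiltonian is, up to `o(1)` as `L → ∞` uniformly on
compacts of `(μ, h₀)`, the envelope `inf_{h ≥ h₀} [E₀(A_L(h))/L² + (h − h₀)²/g]` of the SOURCED energy
densities — every bit a crutch word carries is a bit of the sourced energy curve `h ↦ E₀(A_L(h))`.
WHAT THIS IS NOT: a statement about the Hubbard model at `g = 0`, an order-parameter floor, or a
thermodynamic-limit statement. Bogolyubov Jr.–Brankov–Zagrebnov–Kurbatov–Tonchev (1984);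
Bru–de Siqueira Pedra, Mem. AMS 224 (2013), Appendix, Theorem 107. -/
theorem ahmTT'_t0 (tp U g M H₀ : ℝ) (hg : 0 < g) :
    (∀ (L : ℕ) [NeZero L] (μ h₀ h : ℝ),
      (dWaveSourceTorusTT' L tp U μ h₀ - ((g / (L : ℝ) ^ 2 : ℝ) : ℂ) •
          ((pairField dWaveFormFactor L)ᴴ * pairField dWaveFormFactor L)).groundEnergy ≤
        (dWaveSourceTorusTT' L tp U μ h).groundEnergy + (h - h₀) ^ 2 * (L : ℝ) ^ 2 / g) ∧
    (∀ ε : ℝ, 0 < ε → ∃ L₀ : ℕ, ∀ (L : ℕ) [NeZero L], L₀ ≤ L → ∀ μ : ℝ, |μ| ≤ M →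
      ∀ h₀ : ℝ, 0 ≤ h₀ → h₀ ≤ H₀ → ∃ h : ℝ, h₀ ≤ h ∧
        h ≤ h₀ + (2 * g * (2 * ∑ e ∈ insert (0 : Site 2) unitSteps,
          |dWaveFormFactor e / Real.sqrt 2|) + Real.sqrt (g * ε)) ∧
        (dWaveSourceTorusTT' L tp U μ h).groundEnergy + (h - h₀) ^ 2 * (L : ℝ) ^ 2 / g ≤
          (dWaveSourceTorusTT' L tp U μ h₀ - ((g / (L : ℝ) ^ 2 : ℝ) : ℂ) •
              ((pairField dWaveFormFactor L)ᴴ * pairField dWaveFormFactor L)).groundEnergy +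
            ε * (L : ℝ) ^ 2) := by
  refine ⟨fun L _ μ h₀ h => ahmTT'_groundEnergy_model_le L tp U μ h₀ h hg, fun ε hε => ?_⟩
  obtain ⟨L₀, hL₀⟩ := ahmTT'_groundEnergy_bound tp U g M H₀ ε hg hε
  refine ⟨L₀, fun L _ hL μ hμ h₀ hh₀ hh₀H => ?_⟩
  obtain ⟨h, hh, hb⟩ := hL₀ L hL μ hμ h₀ hh₀ hh₀H
  have hloc := ahmTT'_abs_sub_le_of_bound L tp U μ h₀ h hg hε.le hb
  rw [abs_of_nonneg (sub_nonneg.2 hh)] at hloc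
  exact ⟨h, hh, by linarith, hb⟩

end Envelope

/-! ### The card's D1 object by name: `crutchTorusTT'` (`Observables/CrutchODLROFloor.lean`) -/

section CrutchByName

/-- `crutchTorusTT'` unfolded: `H_{g,L} = A_L(0) − (g/L²)Δ_dᴴΔ_d` (definitional; recorded as a
rewrite lemma for consumers of this file's envelope statements). -/
theorem crutchTorusTT'_eq_model (L : ℕ) [NeZero L] (tp U μ g : ℝ) :
    crutchTorusTT' L tp U μ g =
      dWaveSourceTorusTT' L tp U μ 0 - ((g / (L : ℝ) ^ 2 : ℝ) : ℂ) •
        ((pairField dWaveFormFactor L)ᴴ * pairField dWaveFormFactor L) := rfl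

/-- **BN-T1 on the card's D1 object, by name.** For the BCS-crutch Hamiltonian
`crutchTorusTT' L t' U μ g = A_L(0) − (g/L²)Δ_dᴴΔ_d` of card `bcs-crutch-odlro-floor`
(`Observables/CrutchODLROFloor.lean`, hubbard-pc-lens-finite-1 / hubbard-cq-p2):
(easy, every `L`, `μ`, `h`) `E₀(crutchTorusTT' L t' U μ g) ≤ E₀(A_L(h)) + h²L²/g`
(cf. `groundEnergy_crutch_le` there); (hard) `∀ ε > 0 ∃ L₀ ∀ L ≥ L₀ ∀ |μ| ≤ M ∃ h ∈ [0, 2g‖P‖ + √(gε)]`,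
`E₀(A_L(h)) + h²L²/g ≤ E₀(crutchTorusTT' L t' U μ g) + εL²`. So every certified window on the
crutch ground-state energy is, up to `o(L²)`, a window on `inf_{0 ≤ h ≤ 2g‖P‖+o(1)} [E₀(A_L(h)) + h²L²/g]`
— a functional of the SOURCED energy curve alone (the «does-not-give» column: no bit beyond the
chord data). Bogolyubov Jr. et al. (1984); Bru–de Siqueira Pedra (2013), Theorem 107. -/
theorem crutchTorusTT'_groundEnergy_envelope (tp U g M : ℝ) (hg : 0 < g) :
    (∀ (L : ℕ) [NeZero L] (μ h : ℝ),
      (crutchTorusTT' L tp U μ g).groundEnergy ≤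
        (dWaveSourceTorusTT' L tp U μ h).groundEnergy + h ^ 2 * (L : ℝ) ^ 2 / g) ∧
    (∀ ε : ℝ, 0 < ε → ∃ L₀ : ℕ, ∀ (L : ℕ) [NeZero L], L₀ ≤ L → ∀ μ : ℝ, |μ| ≤ M →
      ∃ h : ℝ, 0 ≤ h ∧
        h ≤ 2 * g * (2 * ∑ e ∈ insert (0 : Site 2) unitSteps, |dWaveFormFactor e / Real.sqrt 2|) +
          Real.sqrt (g * ε) ∧
        (dWaveSourceTorusTT' L tp U μ h).groundEnergy + h ^ 2 * (L : ℝ) ^ 2 / g ≤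
          (crutchTorusTT' L tp U μ g).groundEnergy + ε * (L : ℝ) ^ 2) := by
  obtain ⟨heasy, hhard⟩ := ahmTT'_t0 tp U g M 0 hg
  refine ⟨fun L _ μ h => ?_, fun ε hε => ?_⟩
  · have h1 := heasy L μ 0 h
    rw [sub_zero] at h1
    rw [crutchTorusTT'_eq_model]
    exact h1
  · obtain ⟨L₀, hL₀⟩ := hhard ε hε
    refine ⟨L₀, fun L _ hL μ hμ => ?_⟩
    obtain ⟨h, hh, hloc, hb⟩ := hL₀ L hL μ hμ 0 le_rfl le_rfl
    rw [sub_zero] at hb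
    rw [zero_add] at hloc
    refine ⟨h, hh, hloc, ?_⟩
    rw [crutchTorusTT'_eq_model]
    exact hb

end CrutchByName

end Summit.Ventures.CertifiedManyBodySolver.Observables.SourcedTorusAHM

end
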